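import Mathlib
import HarnessLib
import Summits.NavierStokesRegularity.NavierStokesRegularity.Theorems.LoopPeriodRatchetNoPlanarExtremumOrbit
import Summits.NavierStokesRegularity.NavierStokesRegularity.Theorems.PoloidalWindowDoorPoloidalWindowRigidityHotLoopPrelim

/-!
# Route `PoloidalWindowDoor`, crux `PoloidalWindowRigidity` (K2, stmt-NavierStokesRegularity-19708) — the hot-loop
# construction with the LEVEL AS INPUT (towards the null-present half of stub HP1 `stub_islandOrNull`, line
# `hot_loops` v2, ns-idea-8 g6)

Cell ns-regularity-ideate, seat ns-poloidal-K2-p2 g11 (stub-worker on K2; `--supports` the crux item).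

`…HotLoopCore.exists_periodic_orbit_of_isolated_hot_piece` chooses its own regular level `c` by the Sard substitute and
needs `X ≠ 0` on the whole punctured island.  Here the cut-off level-curve datum and the orbit (parts (e)–(f) of that
proof, verbatim) are packaged for a GIVEN level `c`: **`exists_periodic_orbit_of_hot_level`** — `X ∈ C²` horizontal,
`f ∈ C¹` with `Df(X) ≡ 0`, a compact `K ∋ y₀` with a scale `u > 0` such that `f < c` on the planar collar
`{u/2 ≤ infDist(·,K) ≤ 9u}`, a level point `p` (`f p = c`, `infDist(p,K) < u/2`, in the plane), and on the inner level
piece `Z_c = {f = c} ∩ {infDist < u/2} ∩ plane`: `∇_h f ≠ 0` and `X ≠ 0`.  Then `y′ = X(y)` has a non-stationary periodic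
orbit.  (So the dichotomy of HP1 only has to produce ONE regular level near the top whose inner piece avoids the zeros of
`X`.)

WHAT THIS IS NOT: not a claim about Navier–Stokes — planar topology for one stub of an ideator line of a door route
(bears_on LADDER-NS N0, rung N0-LocalTubeDoorPoloidal).
-/

noncomputable section

-- the summit and its single sub-problem share the name (CONVENTIONS §1), as in every Theorems file
set_option linter.dupNamespace false

namespace Summit.NavierStokesRegularity.NavierStokesRegularity.Theorems.PoloidalWindowDoorPoloidalWindowRigidityHotLoopLevel

open Set Function Filter Topology Metric
open Summit.NavierStokesRegularity.NavierStokesRegularity.Theorems.LoopPeriodRatchetNoPlanarExtremumOrbit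
open Summit.NavierStokesRegularity.NavierStokesRegularity.Theorems.PoloidalWindowDoorPoloidalWindowRigidityHotLoopPrelim

/-- **Hot loop on a given regular level.**  See the module docstring. -/
theorem exists_periodic_orbit_of_hot_level
    {X : EuclideanSpace ℝ (Fin 3) → EuclideanSpace ℝ (Fin 3)} (hX : ContDiff ℝ 2 X) (hX2 : ∀ y, X y 2 = 0)
    {f : EuclideanSpace ℝ (Fin 3) → ℝ} (hf1 : ContDiff ℝ 1 f) (hfX : ∀ y, fderiv ℝ f y (X y) = 0)
    {y₀ : EuclideanSpace ℝ (Fin 3)} {K : Set (EuclideanSpace ℝ (Fin 3))} (hKne : K.Nonempty)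
    {R₀ : ℝ} (hKR : K ⊆ closedBall y₀ R₀) {u c : ℝ} (hu0 : 0 < u)
    (hcollar : ∀ y : EuclideanSpace ℝ (Fin 3), y 2 = y₀ 2 → u / 2 ≤ infDist y K → infDist y K ≤ 9 * u → f y < c)
    {p : EuclideanSpace ℝ (Fin 3)} (hp2 : p 2 = y₀ 2) (hpd : infDist p K < u / 2) (hpf : f p = c)
    (hreg : ∀ z : EuclideanSpace ℝ (Fin 3), z 2 = y₀ 2 → infDist z K < u / 2 → f z = c →
      (fderiv ℝ f z (EuclideanSpace.single 0 1) ≠ 0 ∨ fderiv ℝ f z (EuclideanSpace.single 1 1) ≠ 0) ∧ X z ≠ 0) :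
    ∃ (γ : ℝ → EuclideanSpace ℝ (Fin 3)) (ℓ : ℝ), 0 < ℓ ∧ (∀ θ, HasDerivAt γ (X (γ θ)) θ) ∧
      (∀ θ, γ (θ + ℓ) = γ θ) ∧ X (γ 0) ≠ 0 := by
  set d : EuclideanSpace ℝ (Fin 3) → ℝ := fun y => infDist y K with hd
  have hdc : Continuous d := continuous_infDist_pt K
  set e0 : EuclideanSpace ℝ (Fin 3) := EuclideanSpace.single 0 1 with he0
  set e1 : EuclideanSpace ℝ (Fin 3) := EuclideanSpace.single 1 1 with he1
  set e2 : EuclideanSpace ℝ (Fin 3) := EuclideanSpace.single 2 1 with he2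
  -- (e) the cut-off level-curve datum
  obtain ⟨ρ, hρs, hρ0, hρ1, hρ_one, hρ_zero⟩ := exists_cutoff_infDist hKne hu0
  obtain ⟨ρ', hρ's, hρ'0, hρ'1, hρ'_one, hρ'_zero⟩ := exists_cutoff_infDist hKne (u := 3 * u) (by positivity)
  have hρc : ContDiff ℝ 1 ρ := hρs.of_le (by exact_mod_cast le_top)
  have hρ'c : ContDiff ℝ 1 ρ' := hρ's.of_le (by exact_mod_cast le_top)
  set H0 : EuclideanSpace ℝ (Fin 3) → ℝ := fun y => ρ' y * (c - f y) + (1 - ρ' y) with hH0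
  set H1 : EuclideanSpace ℝ (Fin 3) → ℝ := fun y => y 2 - y₀ 2 with hH1
  set Hc : Fin 2 → EuclideanSpace ℝ (Fin 3) → ℝ := ![H0, H1] with hHc
  set H : EuclideanSpace ℝ (Fin 3) → (Fin 2 → ℝ) := fun y i => Hc i y with hH
  set V : EuclideanSpace ℝ (Fin 3) → EuclideanSpace ℝ (Fin 3) := fun y => ρ y • X y with hV
  have hHapp0 : ∀ y, H y 0 = H0 y := fun y => rfl
  have hHapp1 : ∀ y, H y 1 = H1 y := fun y => rfl
  -- the linearised datum near the hot piece
  set G0 : EuclideanSpace ℝ (Fin 3) → ℝ := fun y => c - f y with hG0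
  set Gc : Fin 2 → EuclideanSpace ℝ (Fin 3) → ℝ := ![G0, H1] with hGc
  set G : EuclideanSpace ℝ (Fin 3) → (Fin 2 → ℝ) := fun y i => Gc i y with hG
  have hH0c : ContDiff ℝ 1 H0 := (hρ'c.mul (contDiff_const.sub hf1)).add (contDiff_const.sub hρ'c)
  have hc2 : ContDiff ℝ 1 (fun y : EuclideanSpace ℝ (Fin 3) => y 2) :=
    (EuclideanSpace.proj (2 : Fin 3) : EuclideanSpace ℝ (Fin 3) →L[ℝ] ℝ).contDiff
  have hH1c : ContDiff ℝ 1 H1 := hc2.sub contDiff_const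
  have hG0c : ContDiff ℝ 1 G0 := contDiff_const.sub hf1
  have hHcd : ContDiff ℝ 1 H := by
    rw [hH, contDiff_pi]
    exact Fin.forall_fin_two.2 ⟨hH0c, hH1c⟩
  have hVcd : ContDiff ℝ 1 V := hρc.smul (hX.of_le one_le_two)
  have hH1d : ∀ y w, fderiv ℝ H1 y w = w 2 := by
    intro y w
    have h : HasFDerivAt (fun y : EuclideanSpace ℝ (Fin 3) => y 2 - y₀ 2)
        (EuclideanSpace.proj (2 : Fin 3) : EuclideanSpace ℝ (Fin 3) →L[ℝ] ℝ) y :=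
      ((EuclideanSpace.proj (2 : Fin 3) : EuclideanSpace ℝ (Fin 3) →L[ℝ] ℝ).hasFDerivAt).sub_const (y₀ 2)
    rw [hH1, h.fderiv]; rfl
  have hG0d : ∀ y w, fderiv ℝ G0 y w = -fderiv ℝ f y w := by
    intro y w; rw [hG0, fderiv_const_sub, _root_.neg_apply]
  have hGd : ∀ y w, fderiv ℝ G y w = ![-fderiv ℝ f y w, w 2] := by
    intro y w
    rw [hG, fderiv_pi (Fin.forall_fin_two.2 ⟨(hG0c.differentiable one_ne_zero) y, (hH1c.differentiable one_ne_zero) y⟩)]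
    ext i
    fin_cases i
    · simp [hGc, hG0d]
    · simp [hGc, hH1d]
  -- near the hot piece (`d < 3u`), `H` agrees with `G`
  have hHG : ∀ y : EuclideanSpace ℝ (Fin 3), d y < 3 * u → H =ᶠ[𝓝 y] G := by
    intro y hy
    have hopen : IsOpen {z : EuclideanSpace ℝ (Fin 3) | d z < 3 * u} := isOpen_lt hdc continuous_const
    filter_upwards [hopen.mem_nhds hy] with y' hy'
    funext i
    fin_cases i
    · show H0 y' = G0 y'
      simp only [hH0, hG0, hρ'_one y' hy', one_mul, sub_self, add_zero]
    · rfl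
  have hfdH : ∀ y : EuclideanSpace ℝ (Fin 3), d y < 3 * u → ∀ w,
      fderiv ℝ H y w = ![-fderiv ℝ f y w, w 2] := by
    intro y hy w
    rw [(hHG y hy).fderiv_eq, hGd]
  -- (ii) `dH(V) = 0` everywhere
  have hHV : ∀ y, fderiv ℝ H y (V y) = 0 := by
    intro y
    by_cases hy : d y < 3 * u
    · rw [hfdH y hy]
      have h1 : fderiv ℝ f y (V y) = 0 := by
        rw [hV]; dsimp only; rw [map_smul, hfX, smul_zero]
      have h2 : V y 2 = 0 := by simp [hV, hX2]
      rw [h1, h2, neg_zero]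
      ext i; fin_cases i <;> rfl
    · have h0 : V y = 0 := by
        rw [hV]; dsimp only; rw [hρ_zero y (not_lt.1 hy), zero_smul]
      rw [h0, map_zero]
  -- the zero set of `H`
  have hzero : ∀ y, H y = 0 → y 2 = y₀ 2 ∧ d y < u / 2 ∧ f y = c := by
    intro y hHy
    have h0 : H0 y = 0 := by rw [← hHapp0]; exact congrFun hHy 0
    have h1 : H1 y = 0 := by rw [← hHapp1]; exact congrFun hHy 1
    have hy2 : y 2 = y₀ 2 := sub_eq_zero.1 h1
    have hyd : d y < u / 2 := by
      by_contra hge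
      rw [not_lt] at hge
      by_cases hfar : 9 * u ≤ d y
      · have hρ'y : ρ' y = 0 := hρ'_zero y (by show 3 * (3 * u) ≤ infDist y K; linarith)
        have : H0 y = 1 := by simp only [hH0, hρ'y, zero_mul, sub_zero, zero_add]
        rw [this] at h0; exact one_ne_zero h0
      · rw [not_le] at hfar
        have hpos : 0 < c - f y := by linarith [hcollar y hy2 hge hfar.le]
        have hval : ρ' y * (c - f y) + (1 - ρ' y) = 0 := h0
        nlinarith [mul_nonneg (hρ'0 y) hpos.le, hρ'1 y]
    refine ⟨hy2, hyd, ?_⟩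
    have : H0 y = c - f y := by
      simp only [hH0, hρ'_one y (by linarith), one_mul, sub_self, add_zero]
    rw [this] at h0; linarith
  -- (iii) `V ≠ 0` on the zero set
  have hXne' : ∀ y, H y = 0 → X y ≠ 0 := by
    intro y hHy
    obtain ⟨hy2, hyd, hyf⟩ := hzero y hHy
    exact (hreg y hy2 hyd hyf).2
  have hVX : ∀ y, H y = 0 → V y = X y := by
    intro y hHy
    obtain ⟨-, hyd, -⟩ := hzero y hHy
    rw [hV]; dsimp only; rw [hρ_one y (by linarith), one_smul]
  have hne : ∀ y, H y = 0 → V y ≠ 0 := fun y hHy => by rw [hVX y hHy]; exact hXne' y hHy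
  -- (iv) `dH` onto on the zero set
  have hsurj : ∀ y, H y = 0 → Function.Surjective (fderiv ℝ H y) := by
    intro y hHy g'
    obtain ⟨hy2, hyd, hyf⟩ := hzero y hHy
    have hy3 : d y < 3 * u := by linarith
    set u₀ : ℝ := fderiv ℝ f y e0 with hu₀
    set u₁ : ℝ := fderiv ℝ f y e1 with hu₁
    set u₂ : ℝ := fderiv ℝ f y e2 with hu₂
    have hN : 0 < u₀ ^ 2 + u₁ ^ 2 := by
      have h' : u₀ ≠ 0 ∨ u₁ ≠ 0 := (hreg y hy2 hyd hyf).1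
      rcases h' with h' | h'
      · have := sq_pos_of_ne_zero h'; positivity
      · have := sq_pos_of_ne_zero h'; positivity
    set lam : ℝ := (-g' 0 - g' 1 * u₂) / (u₀ ^ 2 + u₁ ^ 2) with hlam
    refine ⟨lam • (u₀ • e0 + u₁ • e1) + g' 1 • e2, ?_⟩
    rw [hfdH y hy3]
    have hlin : fderiv ℝ f y (lam • (u₀ • e0 + u₁ • e1) + g' 1 • e2) =
        lam * (u₀ * u₀ + u₁ * u₁) + g' 1 * u₂ := by
      rw [map_add, map_smul, map_add, map_smul, map_smul, map_smul, ← hu₀, ← hu₁, ← hu₂]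
      simp only [smul_eq_mul]
    have hval : -(lam * (u₀ * u₀ + u₁ * u₁) + g' 1 * u₂) = g' 0 := by
      have hN' : u₀ * u₀ + u₁ * u₁ = u₀ ^ 2 + u₁ ^ 2 := by ring
      rw [hN', hlam, div_mul_cancel₀ _ hN.ne']
      ring
    have hcoord : (lam • (u₀ • e0 + u₁ • e1) + g' 1 • e2) 2 = g' 1 := by
      rw [he0, he1, he2]
      simp [PiLp.add_apply, PiLp.smul_apply]
    rw [hlin, hval, hcoord]
    ext i; fin_cases i <;> rfl
  -- boundedness of the zero set and membership of `p`
  have hbdd : ∀ y, H y = 0 → ‖y‖ ≤ ‖y₀‖ + (R₀ + u) := by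
    intro y hHy
    obtain ⟨-, hyd, -⟩ := hzero y hHy
    have hdist : dist y y₀ < R₀ + u := dist_lt_of_infDist_lt hKne hKR (by linarith : d y < u)
    rw [dist_eq_norm] at hdist
    calc ‖y‖ = ‖(y - y₀) + y₀‖ := by rw [sub_add_cancel]
      _ ≤ ‖y - y₀‖ + ‖y₀‖ := norm_add_le _ _
      _ ≤ ‖y₀‖ + (R₀ + u) := by linarith
  have hHp : H p = 0 := by
    funext i
    fin_cases i
    · show H0 p = 0
      simp only [hH0, hρ'_one p (by linarith), one_mul, sub_self, add_zero, hpf]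
    · show H1 p = 0
      simp only [hH1, hp2, sub_self]
  -- (f) the periodic orbit
  obtain ⟨γ, ℓ, hℓ, hγ, hγper, hγ0, hγH⟩ :=
    exists_periodic_orbit_of_regular_level hHcd hVcd hHV hne hsurj hbdd hHp
  refine ⟨γ, ℓ, hℓ, fun θ => ?_, hγper, ?_⟩
  · have h := hγ θ
    rwa [hVX _ (hγH θ)] at h
  · rw [hγ0]; exact hXne' p hHp


end Summit.NavierStokesRegularity.NavierStokesRegularity.Theorems.PoloidalWindowDoorPoloidalWindowRigidityHotLoopLevel

end
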